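import Summits.Ventures.PercRepro.S2FourteenSevenNuFour
import Summits.Ventures.PercRepro.S2TailCell

/-!
# PercRepro — S2: THE COLOOP-FREE CELL `(14, 7)` MODULO ITS SPREAD CASE (p7, gen 14; sub-claim S2; the `p = 14` row)

The coloop-free cell `(14, 7)` (caps `11 / 56 / 307`, `K = 12417`): the cases `ν = 6` (a set of nullity `6` on `≤ 11` points: `#U ≤ 13794`,
`#spanning ≤ 16676`, slack `64/1024`) and `ν = 5` (`39984` / `45386` / `78`) by the concentrated tail, the case `ν = 4` by THE CONTRACTION LEVER
(S2FourteenSevenNuFour), the SPREAD case (no set of nullity `4` on `≤ 9` points) taken as the hypothesis `hspread` — the one case of the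
cell `(14, 7)` still open. **`ThmN.c025_fourteen_seven_cf_of_spread`**. Axioms: standard.
-/

open scoped Matroid

namespace PercRepro

namespace ThmN

open Set

variable {α : Type}

/-- The tail side of the cell `(14, 7)` on the caps `11 / 56 / 307` with the spanning count `S` a parameter: the rank-`≤ 5` part
of the kit's tail is exactly `1673421152 / 14805`. -/
theorem tail_fourteen_seven_cf (S m : ℕ) (h : (1024 : ℚ) * ((1673421152 / 14805 : ℚ) + (S : ℚ)) ≤ (m : ℚ) * 2 ^ 21) :
    1024 * ((((14 + 7).choose 4 : ℚ) +
      (∑ j ∈ Finset.range 6, (Nat.choose (min 5 ((7 + 3) / 2 + 1 - 2)) j : ℚ) / (((j + 1) + 3 * (j + 1).choose 2 + 3 * (j + 1).choose 3 + 2 * (j + 1).choose 4 : ℕ) : ℚ)) *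
        ((11 * (14 + 7 - 3).choose 2 + 56 * (14 + 7 - 4) + 307 : ℕ) : ℚ) +
      ((∑ j ∈ Finset.range 6, (Nat.choose 5 j : ℚ) / (((j + 1) + 3 * (j + 1).choose 2 + 3 * (j + 1).choose 3 + 2 * (j + 1).choose 4 : ℕ) : ℚ)) -
        (∑ j ∈ Finset.range 6, (Nat.choose (min 5 ((7 + 3) / 2 + 1 - 2)) j : ℚ) / (((j + 1) + 3 * (j + 1).choose 2 + 3 * (j + 1).choose 3 + 2 * (j + 1).choose 4 : ℕ) : ℚ))) *
        ((10 : ℕ).choose 5 : ℚ)) +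
      (((14 + 7).choose 3 * 2 ^ 3 + (14 + 7).choose 2 * 2 + (14 + 7) + 1 : ℕ) : ℚ) +
      (((14 + 7).choose 5 : ℚ) + (∑ j ∈ Finset.range (7), (Nat.choose (min 13 ((7 + 6) / 2 + 1 - 2)) j : ℚ) / (((j + 1) + 3 * (j + 1).choose 2 + 3 * (j + 1).choose 3 + 2 * (j + 1).choose 4 : ℕ) : ℚ)) * ((11 * (14 + 7 - 3).choose 3 + 56 * (14 + 7 - 4).choose 2 + 307 * (14 + 7 - 5) + (7 + 5).choose 6 : ℕ) : ℚ) +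
        ((∑ j ∈ Finset.range (7), (Nat.choose (min 19 (5 + 7) - 6) j : ℚ) / (((j + 1) + 3 * (j + 1).choose 2 + 3 * (j + 1).choose 3 + 2 * (j + 1).choose 4 : ℕ) : ℚ)) - (∑ j ∈ Finset.range (7), (Nat.choose (min 13 ((7 + 6) / 2 + 1 - 2)) j : ℚ) / (((j + 1) + 3 * (j + 1).choose 2 + 3 * (j + 1).choose 3 + 2 * (j + 1).choose 4 : ℕ) : ℚ))) *
        ((min 19 (5 + 7)).choose 6 : ℚ)) +
      (S : ℚ)) ≤ (m : ℚ) * 2 ^ (14 + 7) := by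
  have hsm : (∑ j ∈ Finset.range (7), (Nat.choose (min 13 ((7 + 6) / 2 + 1 - 2)) j : ℚ) / (((j + 1) + 3 * (j + 1).choose 2 + 3 * (j + 1).choose 3 + 2 * (j + 1).choose 4 : ℕ) : ℚ)) = 12767 / 4230 := by
    norm_num [Finset.sum_range_succ, Nat.choose]
  have hsg : (∑ j ∈ Finset.range (7), (Nat.choose (min 19 (5 + 7) - 6) j : ℚ) / (((j + 1) + 3 * (j + 1).choose 2 + 3 * (j + 1).choose 3 + 2 * (j + 1).choose 4 : ℕ) : ℚ)) = 414767 / 103635 := by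
    norm_num [Finset.sum_range_succ, Nat.choose]
  have hs4m : (∑ j ∈ Finset.range 6, (Nat.choose (min 5 ((7 + 3) / 2 + 1 - 2)) j : ℚ) / (((j + 1) + 3 * (j + 1).choose 2 + 3 * (j + 1).choose 3 + 2 * (j + 1).choose 4 : ℕ) : ℚ)) = 523 / 225 := by
    norm_num [Finset.sum_range_succ, Nat.choose]
  have hs4g : (∑ j ∈ Finset.range 6, (Nat.choose 5 j : ℚ) / (((j + 1) + 3 * (j + 1).choose 2 + 3 * (j + 1).choose 3 + 2 * (j + 1).choose 4 : ℕ) : ℚ)) = 12767 / 4230 := by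
    norm_num [Finset.sum_range_succ, Nat.choose]
  rw [hsm, hsg, hs4m, hs4g]
  norm_num [Nat.choose] at h ⊢
  linarith

/-- **The coloop-free cell `(14, 7)` modulo its spread case** (`hspread`: `RLS M 14 5` on every coloop-free core of rank `14` on `21` points with no
set of nullity `6` on `≤ 11` points, none of nullity `5` on `≤ 10`, none of nullity `4` on `≤ 9`). -/
theorem c025_fourteen_seven_cf_of_spread
    (hspread : ∀ (M : Matroid α) [M.Finite], M.eRank = ((14 : ℕ) : ℕ∞) → M.E.ncard = 14 + 7 →
      (∀ e ∈ M.E, ∃ A ⊆ M.E \ {e}, e ∉ M.closure A ∧ e ∉ M.closure ((M.E \ {e}) \ A)) → (∀ e, ¬ M.IsColoop e) →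
      ¬ (∃ W ⊆ M.E, W.ncard ≤ 11 ∧ W.encard = M.eRk W + 6) → ¬ (∃ W ⊆ M.E, W.ncard ≤ 10 ∧ W.encard = M.eRk W + 5) →
      ¬ (∃ W ⊆ M.E, W.ncard ≤ 9 ∧ W.encard = M.eRk W + 4) → RLS M 14 5)
    (M : Matroid α) [M.Finite]
    (hR : M.eRank = ((14 : ℕ) : ℕ∞)) (hn : M.E.ncard = 14 + 7)
    (hfree : ∀ e ∈ M.E, ∃ A ⊆ M.E \ {e}, e ∉ M.closure A ∧ e ∉ M.closure ((M.E \ {e}) \ A)) (hK : ∀ e, ¬ M.IsColoop e) :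
    RLS M 14 5 := by
  classical
  have hd : M.E.encard = M.eRank + ((7 : ℕ) : ℕ∞) := by
    rw [hR, ← M.ground_finite.cast_ncard_eq, hn]
    push_cast
    ring
  obtain ⟨hs3, hs4, hs5⟩ := caps_fourteen_seven_cf M hd hn hfree hK
  have full : ∀ (k : ℕ) {W : Set α}, W ⊆ M.E → W.encard = M.eRk W + k →
      Matroid.topCount M 14 5 ≤ ∑ m ∈ Finset.Icc 5 7, ∑ j ∈ Finset.Icc (m + k - 7) m,
        W.ncard.choose j * (14 + 7 - W.ncard).choose (m - j) := by
    intro k W hW hWk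
    refine (S2.topCount_le_sum_spanning M hR hd 5).trans ?_
    refine Finset.sum_le_sum (fun m _ => ?_)
    have h := S2.ncard_spanning_compl_le_of_nullity M hW hd hWk (m := m)
    rw [hn] at h
    exact h
  have span : ∀ (k : ℕ) {W : Set α}, W ⊆ M.E → W.encard = M.eRk W + k →
      {X : Set α | X ⊆ M.E ∧ M.eRk X = M.eRank}.ncard ≤ ∑ m ∈ Finset.range (7 + 1), ∑ j ∈ Finset.Icc (m + k - 7) m,
        W.ncard.choose j * (14 + 7 - W.ncard).choose (m - j) := by
    intro k W hW hWk
    have h := S2.ncard_spanning_le_of_nullity M hW hd hWk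
    rw [hn] at h
    exact h
  have cell : ∀ (U S m : ℕ), Matroid.topCount M 14 5 ≤ U → {X : Set α | X ⊆ M.E ∧ M.eRk X = M.eRank}.ncard ≤ S → m ≤ 1024 →
      1024 * (U : ℚ) ≤ ((1024 - m : ℕ) : ℚ) * 2 ^ (7 - 5) * (12417 : ℚ) →
      (1024 : ℚ) * ((1673421152 / 14805 : ℚ) + (S : ℚ)) ≤ (m : ℚ) * 2 ^ 21 → RLS M 14 5 := by
    intro U S m hU hS hm hpoly htail
    rw [RLS_iff]
    exact c025_core_five_cell_of_topCount_spanning_xqictq5g M 14 7 (by norm_num) hR hn hfree 11 56 307 hs3 hs4 hs5 U hU S hS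
      12417 (by norm_num) (phiK 14 5) (by rw [S2.phiK_fourteen_five]; norm_num) ⟨m, hm, hpoly, tail_fourteen_seven_cf S m htail⟩
  by_cases h6 : ∃ W ⊆ M.E, W.ncard ≤ 11 ∧ W.encard = M.eRk W + 6
  · obtain ⟨W, hW, hWn, hWk⟩ := h6
    have hU' : Matroid.topCount M 14 5 ≤ 13794 := by
      refine (full 6 hW hWk).trans ?_
      generalize W.ncard = w at hWn ⊢
      interval_cases w <;> decide
    have hS' : {X : Set α | X ⊆ M.E ∧ M.eRk X = M.eRank}.ncard ≤ 16676 := by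
      refine (span 6 hW hWk).trans ?_
      generalize W.ncard = w at hWn ⊢
      interval_cases w <;> decide
    exact cell 13794 16676 64 hU' hS' (by norm_num) (by norm_num) (by norm_num)
  by_cases h5 : ∃ W ⊆ M.E, W.ncard ≤ 10 ∧ W.encard = M.eRk W + 5
  · obtain ⟨W, hW, hWn, hWk⟩ := h5
    have hU' : Matroid.topCount M 14 5 ≤ 39984 := by
      refine (full 5 hW hWk).trans ?_
      generalize W.ncard = w at hWn ⊢
      interval_cases w <;> decide
    have hS' : {X : Set α | X ⊆ M.E ∧ M.eRk X = M.eRank}.ncard ≤ 45386 := by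
      refine (span 5 hW hWk).trans ?_
      generalize W.ncard = w at hWn ⊢
      interval_cases w <;> decide
    exact cell 39984 45386 78 hU' hS' (by norm_num) (by norm_num) (by norm_num)
  by_cases h4 : ∃ W ⊆ M.E, W.ncard ≤ 9 ∧ W.encard = M.eRk W + 4
  · exact c025_fourteen_seven_cf_nu_four M hR hn hfree hK h5 h4
  · exact hspread M hR hn hfree hK h6 h5 h4

end ThmN

end PercRepro
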